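import Summits.ABC.StewartYu.PadicG3TwoThirdClass
import Summits.ABC.StewartYu.PadicMulticubicLiouvilleRat
import Summits.ABC.StewartYu.DescentThirdLiouvilleQ
import HarnessLib

/-!
# Cell abc-stewartyu, Gen-3 frame at `p = 2` (crux `Y07Two`, stmt-ABC-19659), F5 brick 3: the THIRD-POINT
# LIOUVILLE STEP — `2`-adic smallness of `φ_τ(s/3)` forces every triadic class sum to vanish

`Summits/ABC/StewartYu/PadicG3TwoThirdLiouville.lean` — cell `abc-stewartyu` (HOME `run/shared/lean/pub/abc-stewartyu/`),
route `PadicPrimesKummerThird`, seat p3 (g5), F-two LEAD; third brick of F5 (Yu's Lemma 5.3 at `q = 3`, `p = 2`)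
for the generic signed family on `TwoSetup`.

By `PadicG3TwoThirdClass.g3Φ_third_eq_ev3`, `φ_τ(s/3) = ev3 cbrt (thirdVec B p τ s)`.  Under the `3`-Kummer
condition on all `d + 1` generators, lit's RATIONAL multicubic Liouville inequality
(`MulticubLiouville.norm_ev3_ge_padic_rat`, cube roots `cbrt k` with `cbrt³ = all`, `‖cbrt‖ ≤ 1`) bounds
`‖ev3 cbrt c‖` from below by `1/(6·D·M·P(all)⁵)^{3^{d+2}−1}` for a nonzero rational vector `c` with common
denominator `D` and `ℓ¹`-norm `≤ M`.  Hence (`thirdVec_eq_zero_of_norm_lt`): if `‖φ_τ(s/3)‖₂` is smaller than that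
threshold, ALL `3^{d+1}` class sums `thirdVec B p τ s r` vanish — in particular the class of any chosen unknown,
which is the input of the re-indexing `u = 3u′ + v` (`PadicG3TwoSlabReindex`).

WHAT THIS IS NOT: no sizes `D`, `M` (record: from `den₀`, `M₀`, `Xb`, `monDen`, `qPart3`); no re-indexing; no crux moves.

References: K. Yu, Compositio Math. 74 (1990), Lemma 2.5 (`q = 3`); M. Waldschmidt, Acta Arith. 37 (1980), Lemma 3.7;
K. Yu, Acta Math. 211 (2013), Lemma 5.3.
-/

noncomputable section

open Finset NormedSpace
open Literature.NumberTheory.Transcendental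
open Literature.NumberTheory.Transcendental.CW77 (heightProd)
open Literature.NumberTheory.Transcendental.CW77.Setup (Tau tauNorm)

namespace Summit.ABC.StewartYu

namespace TwoSetup

variable (S : TwoSetup) {ι : Type*} (R : ι → Polynomial ℚ) (u : ι → Fin S.d → ℤ) (uθ : ι → ℤ)

/-- **THE THIRD-POINT LIOUVILLE STEP** (Yu's Lemma 5.3 at `q = 3`, `p = 2`, rational generators, signed exponents):
under the `3`-Kummer condition, if the class-sum vector `thirdVec B p τ s` has a common denominator `D ≥ 1` and
`ℓ¹`-norm `≤ M` (`M ≥ 1`) and `‖φ_τ(s/3)‖₂ < 1/(6·D·M·P(all)⁵)^{3^{d+2}−1}`, then `thirdVec B p τ s = 0`.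
[cite: Yu1990, Lemma 2.5] [cite: Waldschmidt1980, Lemma 3.7] -/
theorem thirdVec_eq_zero_of_norm_lt
    (hK : ∀ κ : Fin (S.d + 1) → ℕ, (∃ j, ¬ 3 ∣ κ j) → ∀ γ : ℚ, ∏ j, S.toQ.all j ^ κ j ≠ γ ^ 3)
    (B : Finset ι) (p : ι → ℤ) (τ : Tau S.d) (s : ℤ)
    {D : ℕ} (hD : 1 ≤ D) (hden : ∀ r, ∃ z : ℤ, (D : ℚ) * S.thirdVec R u uθ B p τ s r = z)
    {M : ℝ} (hM : 1 ≤ M) (hcM : ∑ r, |(S.thirdVec R u uθ B p τ s r : ℝ)| ≤ M)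
    (hlt : ‖S.g3Φ R u uθ B p τ ((s : ℚ_[2]) * ((3 : ℕ) : ℚ_[2])⁻¹)‖ <
      1 / (6 * (D : ℝ) * M * heightProd S.toQ.all ^ 5) ^ (3 ^ (S.d + 1 + 1) - 1)) :
    S.thirdVec R u uθ B p τ s = 0 := by
  haveI : Fact (Nat.Prime 2) := ⟨Nat.prime_two⟩
  by_contra hne
  have hge := MulticubLiouville.norm_ev3_ge_padic_rat (p := 2) (S.d + 1) S.toQ.all hK S.cbrt
    S.cbrt_pow_three_cast S.norm_cbrt_le_one _ hne D hD hden M hM hcM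
  rw [S.g3Φ_third_eq_ev3] at hlt
  exact absurd hge (not_le.mpr hlt)

/-- **Corollary: every single class sum vanishes**, in particular the class of a chosen unknown `i₁`
(`r = res3 κ_{i₁} s`) — the equation the re-indexed family of the next level satisfies at the integer point
`s`. [cite: Yu2013, Lemma 5.4; shape only] -/
theorem thirdVec_apply_eq_zero_of_norm_lt
    (hK : ∀ κ : Fin (S.d + 1) → ℕ, (∃ j, ¬ 3 ∣ κ j) → ∀ γ : ℚ, ∏ j, S.toQ.all j ^ κ j ≠ γ ^ 3)
    (B : Finset ι) (p : ι → ℤ) (τ : Tau S.d) (s : ℤ)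
    {D : ℕ} (hD : 1 ≤ D) (hden : ∀ r, ∃ z : ℤ, (D : ℚ) * S.thirdVec R u uθ B p τ s r = z)
    {M : ℝ} (hM : 1 ≤ M) (hcM : ∑ r, |(S.thirdVec R u uθ B p τ s r : ℝ)| ≤ M)
    (hlt : ‖S.g3Φ R u uθ B p τ ((s : ℚ_[2]) * ((3 : ℕ) : ℚ_[2])⁻¹)‖ <
      1 / (6 * (D : ℝ) * M * heightProd S.toQ.all ^ 5) ^ (3 ^ (S.d + 1 + 1) - 1))
    (r : Fin (S.d + 1) → Fin 3) :
    S.thirdVec R u uθ B p τ s r = 0 := by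
  have h := S.thirdVec_eq_zero_of_norm_lt R u uθ hK B p τ s hD hden hM hcM hlt
  exact congrFun h r

end TwoSetup

end Summit.ABC.StewartYu

end
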